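import Summits.QuantumFields.BalabanUV.InfraRed.StrongCouplingStaggerWeights
import HarnessLib

/-!
# Phase-class weights for the staggered temporal forest (W4b): the six plaquettes through a space-like link

Observatory of the non-perturbative crossover; no mass-gap claim.

ABSOLUTE RULE of this package: no internally-minted statement enters as a cited fact; every hypothesis is either
kernel-proved in this package or a verbatim quotation of a PUBLISHED theorem with page reference. The manuscript(s)
under audit are not citable for their own disputed steps. Everything below is elementary lattice combinatorics on the
discrete torus `(ZMod L)^4`, kernel-proved ([folklore]).

WHAT. `StrongCouplingStaggerWeights` (W4) bounded the weighted Dobrushin rows of the staggered temporal forest for TWO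
weight classes by `14 + t` and `12/t` (`ρ = 7 + √61 ≈ 14.81`). Here space-like weights may depend on the STAGGERING
PHASE: `phaseWeight u uT (w, k) = u (stagPhase w − 1)` for `k ≠ 3`, `= uT` for `k = 3`. New input: the exact bookkeeping
of ALL SIX plaquettes through a space-like link `e = (x + e₃, i)` of class `a = stagPhase x` (§2; `plaqAt`,
`mem_plaqsThrough_spatial`): weighted free slots `2u(a−2) + u(a)` and `u(a) + 2u(a+2)` in each space-like plane
`{i, j}` (both orientations), `[a=2]uT + u(a+1) + [a=0]uT` and `[a=3]uT + u(a−1) + [a=1]uT` in the plane `{i, 3}`. Hence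
(§3) a class-`a` space-like row is at most `4u(a−2) + 4u(a) + 4u(a+2) + u(a+1) + u(a−1) + ([a=0]+[a=1]+[a=2]+[a=3]) uT`,
a dynamic time-like row at most `6 max(u 0 + u 1, u 2 + u 3)`; `weightedRow_phase_le` packages both as the weighted
row inequality `∑_{y ∉ F} n(e,y) w(y) ≤ ρ w(e)`. A five-class table (`ρ = 723/50`) is certified elsewhere.
NOT CLAIMED: any statement about measures; no mass-gap claim.
-/

noncomputable section

open Finset
open Literature.MathematicalPhysics.QuantumFieldTheory
open Literature.MathematicalPhysics.QuantumFieldTheory.Balaban1983to89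
open Literature.MathematicalPhysics.QuantumFieldTheory.Balaban1983to89.StrongCouplingTorusWindow
open Summit.QuantumFields.BalabanUV.InfraRed.StrongCouplingForestGauge
open Summit.QuantumFields.BalabanUV.InfraRed.StrongCouplingStaggerForest
open Summit.QuantumFields.BalabanUV.InfraRed.StrongCouplingStaggerWeights

namespace Summit.QuantumFields.BalabanUV.InfraRed.StrongCouplingStaggerPhaseWeights

variable {L : ℕ} [NeZero L]

/-! ## 1. Phase-class weights and small tools -/

omit [NeZero L] in
/-- A sum over `insert a s` of nonnegative terms is at most `f a` plus the sum over `s` (no disjointness needed).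
[folklore] -/
theorem sum_insert_le {α : Type*} [DecidableEq α] (s : Finset α) (a : α) {f : α → ℝ} (hf : ∀ x, 0 ≤ f x) :
    ∑ x ∈ insert a s, f x ≤ f a + ∑ x ∈ s, f x := by
  by_cases ha : a ∈ s
  · rw [insert_eq_of_mem ha]; linarith [hf a]
  · rw [sum_insert ha]

omit [NeZero L] in
/-- A sum of nonnegative terms over at most six listed points is at most the sum of the six values. [folklore] -/
theorem sum_six_le {α : Type*} [DecidableEq α] (a₁ a₂ a₃ a₄ a₅ a₆ : α) {f : α → ℝ} (hf : ∀ x, 0 ≤ f x) :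
    ∑ x ∈ insert a₁ (insert a₂ (insert a₃ (insert a₄ (insert a₅ ({a₆} : Finset α))))), f x ≤
      f a₁ + f a₂ + f a₃ + f a₄ + f a₅ + f a₆ := by
  have h1 := sum_insert_le (insert a₂ (insert a₃ (insert a₄ (insert a₅ ({a₆} : Finset α))))) a₁ hf
  have h2 := sum_insert_le (insert a₃ (insert a₄ (insert a₅ ({a₆} : Finset α)))) a₂ hf
  have h3 := sum_insert_le (insert a₄ (insert a₅ ({a₆} : Finset α))) a₃ hf
  have h4 := sum_insert_le (insert a₅ ({a₆} : Finset α)) a₄ hf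
  have h5 := sum_insert_le ({a₆} : Finset α) a₅ hf
  rw [sum_singleton] at h5; linarith

/-- **Phase-class weights**: a time-like link weighs `uT`, a space-like link `(w, k)` weighs `u (stagPhase w − 1)`
(the class of a space-like link is the staggering phase of the site below it). [folklore] -/
def phaseWeight (u : ZMod L → ℝ) (uT : ℝ) (e : Edge 4 L) : ℝ := if e.2 = 3 then uT else u (stagPhase e.1 - 1)

omit [NeZero L] in
/-- Time-like links weigh `uT`. [folklore] -/
theorem phaseWeight_temporal (u : ZMod L → ℝ) (uT : ℝ) (w : Site 4 L) : phaseWeight u uT (w, (3 : Fin 4)) = uT := by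
  simp [phaseWeight]

omit [NeZero L] in
/-- Space-like links weigh `u (stagPhase w − 1)`. [folklore] -/
theorem phaseWeight_spatial (u : ZMod L → ℝ) (uT : ℝ) (w : Site 4 L) {k : Fin 4} (hk : k ≠ 3) :
    phaseWeight u uT (w, k) = u (stagPhase w - 1) := by
  simp [phaseWeight, hk]

omit [NeZero L] in
/-- Phase-class weights are nonnegative for a nonnegative table. [folklore] -/
theorem phaseWeight_nonneg {u : ZMod L → ℝ} {uT : ℝ} (hu : ∀ a, 0 ≤ u a) (huT : 0 ≤ uT) (e : Edge 4 L) :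
    0 ≤ phaseWeight u uT e := by
  unfold phaseWeight; split_ifs; exacts [huT, hu _]

omit [NeZero L] in
/-- The staggering phase one step DOWN in a space-like direction: `+2`. [folklore] -/
theorem stagPhase_sub_ne (w : Site 4 L) {j : Fin 4} (hj : j ≠ 3) :
    stagPhase (w - Pi.single j 1) = stagPhase w + 2 := by
  have h := stagPhase_shift_ne (x := w - Pi.single j 1) hj
  have hs : (w - Pi.single j 1 : Site 4 L).shift j = w := by simp [Site.shift]
  rw [hs] at h; linear_combination -h

/-- The plaquette based at `z` in the plane `{i, j}` (`i ≠ j`), canonically oriented. [folklore] -/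
def plaqAt (z : Site 4 L) (i j : Fin 4) (h : i ≠ j) : Plaquette 4 L :=
  if hij : i < j then (z, ⟨(i, j), hij⟩) else (z, ⟨(j, i), lt_of_le_of_ne (not_lt.1 hij) (Ne.symm h)⟩)

/-! ## 2. The six plaquettes through a space-like link and their weighted free slots -/

/-- **The plaquettes through a link `(z, i)`**: each lies in a plane `{i, j}` (`j ≠ i`) and is based at `z` or at
`z − e_j`. [folklore] -/
theorem mem_plaqsThrough_spatial {z : Site 4 L} {i : Fin 4} {q : Plaquette 4 L}
    (hq : q ∈ plaqsThrough ((z, i) : Edge 4 L)) :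
    ∃ (j : Fin 4) (h : i ≠ j), q = plaqAt z i j h ∨ q = plaqAt (z - Pi.single j 1) i j h := by
  obtain ⟨y, ⟨⟨μ, ν⟩, hμν⟩⟩ := q
  rw [mem_plaqsThrough, plaqEdgesT_eq] at hq
  simp only [Finset.mem_insert, Finset.mem_singleton] at hq
  rcases hq with h | h | h | h
  · -- `e = tLink1 q = (y, μ)`
    have h1 : z = y := congrArg Prod.fst h
    have h2 : i = μ := congrArg Prod.snd h
    subst h1; subst h2
    exact ⟨ν, ne_of_lt hμν, Or.inl (by simp [plaqAt, hμν])⟩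
  · -- `e = tLink2 q = (y + e_μ, ν)`
    have h1 : z = y.shift μ := congrArg Prod.fst h
    have h2 : i = ν := congrArg Prod.snd h
    subst h2
    have hy : y = z - Pi.single μ 1 := by rw [h1]; simp [Site.shift]
    refine ⟨μ, (ne_of_lt hμν).symm, Or.inr ?_⟩
    rw [← hy]
    simp [plaqAt, not_lt.2 hμν.le]
  · -- `e = tLink3 q = (y + e_ν, μ)`
    have h1 : z = y.shift ν := congrArg Prod.fst h
    have h2 : i = μ := congrArg Prod.snd h
    subst h2
    have hy : y = z - Pi.single ν 1 := by rw [h1]; simp [Site.shift]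
    refine ⟨ν, ne_of_lt hμν, Or.inr ?_⟩
    rw [← hy]
    simp [plaqAt, hμν]
  · -- `e = tLink4 q = (y, ν)`
    have h1 : z = y := congrArg Prod.fst h
    have h2 : i = ν := congrArg Prod.snd h
    subst h1; subst h2
    exact ⟨μ, (ne_of_lt hμν).symm, Or.inl (by simp [plaqAt, not_lt.2 hμν.le])⟩

/-- Upper space-like plaquette through `(x + e₃, i)` in the plane `{i, j}` (`j` space-like): weighted free slots
`2u(a−2) + u(a)`, `a = stagPhase x`. [folklore] -/
theorem slotSum_up_spatial (hL : 4 ≤ L) (u : ZMod L → ℝ) (uT : ℝ) (x : Site 4 L) {i j : Fin 4} (hi : i ≠ 3)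
    (hj : j ≠ 3) (h : i ≠ j) :
    slotSum (staggerForest L) (phaseWeight u uT) (x.shift 3, i) (plaqAt (x.shift 3) i j h) =
      2 * u (stagPhase x - 2) + u (stagPhase x) := by
  have hL1 : 1 < L := by omega
  have c1 : stagPhase x + 1 - 2 - 1 = stagPhase x - 2 := by ring
  have c2 : stagPhase x + 1 - 1 = stagPhase x := by ring
  unfold plaqAt
  split_ifs with hij
  · have he : ((x.shift 3, i) : Edge 4 L) = tLink1 ((x.shift 3, ⟨(i, j), hij⟩) : Plaquette 4 L) := rfl
    have s : tstapleLinks ((x.shift 3, ⟨(i, j), hij⟩) : Plaquette 4 L) (x.shift 3, i) =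
        ![tLink2 (x.shift 3, ⟨(i, j), hij⟩), tLink3 (x.shift 3, ⟨(i, j), hij⟩), tLink4 (x.shift 3, ⟨(i, j), hij⟩)] := by
      rw [he]; exact tstapleLinks_tLink1 _
    simp only [slotSum_eq, s, Matrix.cons_val_zero, Matrix.cons_val_one, Matrix.head_cons, Matrix.cons_val_two,
      Matrix.tail_cons]
    simp only [tLink2, tLink3, tLink4, spatial_not_mem_staggerForest hi, spatial_not_mem_staggerForest hj,
      not_false_eq_true, ite_true, phaseWeight_spatial u uT _ hi, phaseWeight_spatial u uT _ hj,
      stagPhase_shift_ne hi, stagPhase_shift_ne hj, stagPhase_shift_three, c1, c2]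
    ring
  · have hji : j < i := lt_of_le_of_ne (not_lt.1 hij) (Ne.symm h)
    have he : ((x.shift 3, i) : Edge 4 L) = tLink4 ((x.shift 3, ⟨(j, i), hji⟩) : Plaquette 4 L) := rfl
    have s : tstapleLinks ((x.shift 3, ⟨(j, i), hji⟩) : Plaquette 4 L) (x.shift 3, i) =
        ![tLink3 (x.shift 3, ⟨(j, i), hji⟩), tLink2 (x.shift 3, ⟨(j, i), hji⟩), tLink1 (x.shift 3, ⟨(j, i), hji⟩)] := by
      rw [he]; exact tstapleLinks_tLink4 hL1 _
    simp only [slotSum_eq, s, Matrix.cons_val_zero, Matrix.cons_val_one, Matrix.head_cons, Matrix.cons_val_two,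
      Matrix.tail_cons]
    simp only [tLink1, tLink2, tLink3, spatial_not_mem_staggerForest hi, spatial_not_mem_staggerForest hj,
      not_false_eq_true, ite_true, phaseWeight_spatial u uT _ hi, phaseWeight_spatial u uT _ hj,
      stagPhase_shift_ne hi, stagPhase_shift_ne hj, stagPhase_shift_three, c1, c2]
    ring

/-- Lower space-like plaquette through `(x + e₃, i)` in the plane `{i, j}` (based at `x + e₃ − e_j`, `j` space-like):
weighted free slots `u(a) + 2u(a+2)`. [folklore] -/
theorem slotSum_down_spatial (hL : 4 ≤ L) (u : ZMod L → ℝ) (uT : ℝ) (x : Site 4 L) {i j : Fin 4} (hi : i ≠ 3)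
    (hj : j ≠ 3) (h : i ≠ j) :
    slotSum (staggerForest L) (phaseWeight u uT) (x.shift 3, i) (plaqAt (x.shift 3 - Pi.single j 1) i j h) =
      u (stagPhase x) + 2 * u (stagPhase x + 2) := by
  have hL1 : 1 < L := by omega
  have c3 : stagPhase x + 1 + 2 - 2 - 1 = stagPhase x := by ring
  have c4 : stagPhase x + 1 + 2 - 1 = stagPhase x + 2 := by ring
  have hback : (x.shift 3 - Pi.single j 1 : Site 4 L).shift j = x.shift 3 := by simp [Site.shift]
  unfold plaqAt
  split_ifs with hij
  · have he : ((x.shift 3, i) : Edge 4 L) = tLink3 ((x.shift 3 - Pi.single j 1, ⟨(i, j), hij⟩) : Plaquette 4 L) := by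
      simp only [tLink3, hback]
    have s : tstapleLinks ((x.shift 3 - Pi.single j 1, ⟨(i, j), hij⟩) : Plaquette 4 L) (x.shift 3, i) =
        ![tLink2 (x.shift 3 - Pi.single j 1, ⟨(i, j), hij⟩), tLink1 (x.shift 3 - Pi.single j 1, ⟨(i, j), hij⟩),
          tLink4 (x.shift 3 - Pi.single j 1, ⟨(i, j), hij⟩)] := by
      rw [he]; exact tstapleLinks_tLink3 hL1 _
    simp only [slotSum_eq, s, Matrix.cons_val_zero, Matrix.cons_val_one, Matrix.head_cons, Matrix.cons_val_two,
      Matrix.tail_cons]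
    simp only [tLink1, tLink2, tLink4, spatial_not_mem_staggerForest hi, spatial_not_mem_staggerForest hj,
      not_false_eq_true, ite_true, phaseWeight_spatial u uT _ hi, phaseWeight_spatial u uT _ hj,
      stagPhase_shift_ne hi, stagPhase_sub_ne _ hj, stagPhase_shift_three, c3, c4]
    ring
  · have hji : j < i := lt_of_le_of_ne (not_lt.1 hij) (Ne.symm h)
    have he : ((x.shift 3, i) : Edge 4 L) = tLink2 ((x.shift 3 - Pi.single j 1, ⟨(j, i), hji⟩) : Plaquette 4 L) := by
      simp only [tLink2, hback]
    have s : tstapleLinks ((x.shift 3 - Pi.single j 1, ⟨(j, i), hji⟩) : Plaquette 4 L) (x.shift 3, i) =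
        ![tLink3 (x.shift 3 - Pi.single j 1, ⟨(j, i), hji⟩), tLink4 (x.shift 3 - Pi.single j 1, ⟨(j, i), hji⟩),
          tLink1 (x.shift 3 - Pi.single j 1, ⟨(j, i), hji⟩)] := by
      rw [he]; exact tstapleLinks_tLink2 _
    simp only [slotSum_eq, s, Matrix.cons_val_zero, Matrix.cons_val_one, Matrix.head_cons, Matrix.cons_val_two,
      Matrix.tail_cons]
    simp only [tLink1, tLink3, tLink4, spatial_not_mem_staggerForest hi, spatial_not_mem_staggerForest hj,
      not_false_eq_true, ite_true, phaseWeight_spatial u uT _ hi, phaseWeight_spatial u uT _ hj,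
      stagPhase_shift_ne hi, stagPhase_sub_ne _ hj, stagPhase_shift_three, c3, c4]
    ring

/-- Upper time-like plaquette through `(x + e₃, i)`: weighted free slots `[a=2]uT + u(a+1) + [a=0]uT`. [folklore] -/
theorem slotSum_up_three (u : ZMod L → ℝ) (uT : ℝ) (x : Site 4 L) {i : Fin 4} (hi : i < 3) :
    slotSum (staggerForest L) (phaseWeight u uT) (x.shift 3, i) (plaqAt (x.shift 3) i 3 (ne_of_lt hi)) =
      (if stagPhase x = 2 then uT else 0) + u (stagPhase x + 1) + (if stagPhase x = 0 then uT else 0) := by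
  have hi3 : i ≠ 3 := ne_of_lt hi
  have c5 : stagPhase x + 1 + 1 - 1 = stagPhase x + 1 := by ring
  have e2 : (stagPhase x + 1 - 2 = 1) ↔ stagPhase x = 2 := by constructor <;> intro h <;> linear_combination h
  have e0 : (stagPhase x + 1 = 1) ↔ stagPhase x = 0 := by constructor <;> intro h <;> linear_combination h
  unfold plaqAt
  rw [dif_pos hi]
  have he : ((x.shift 3, i) : Edge 4 L) = tLink1 ((x.shift 3, ⟨(i, 3), hi⟩) : Plaquette 4 L) := rfl
  have s : tstapleLinks ((x.shift 3, ⟨(i, 3), hi⟩) : Plaquette 4 L) (x.shift 3, i) =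
      ![tLink2 (x.shift 3, ⟨(i, 3), hi⟩), tLink3 (x.shift 3, ⟨(i, 3), hi⟩), tLink4 (x.shift 3, ⟨(i, 3), hi⟩)] := by
    rw [he]; exact tstapleLinks_tLink1 _
  simp only [slotSum_eq, s, Matrix.cons_val_zero, Matrix.cons_val_one, Matrix.head_cons, Matrix.cons_val_two,
    Matrix.tail_cons]
  simp only [tLink2, tLink3, tLink4, temporal_not_mem_staggerForest, spatial_not_mem_staggerForest hi3,
    not_false_eq_true, ite_true, phaseWeight_spatial u uT _ hi3, phaseWeight_temporal, stagPhase_shift_ne hi3,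
    stagPhase_shift_three, c5, e2, e0]

/-- Lower time-like plaquette through `(x + e₃, i)` (based at `x`): weighted free slots `[a=3]uT + u(a−1) + [a=1]uT`.
[folklore] -/
theorem slotSum_down_three (hL : 4 ≤ L) (u : ZMod L → ℝ) (uT : ℝ) (x : Site 4 L) {i : Fin 4} (hi : i < 3) :
    slotSum (staggerForest L) (phaseWeight u uT) (x.shift 3, i)
        (plaqAt (x.shift 3 - Pi.single 3 1) i 3 (ne_of_lt hi)) =
      (if stagPhase x = 3 then uT else 0) + u (stagPhase x - 1) + (if stagPhase x = 1 then uT else 0) := by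
  have hL1 : 1 < L := by omega
  have hi3 : i ≠ 3 := ne_of_lt hi
  have hx : (x.shift 3 - Pi.single 3 1 : Site 4 L) = x := by simp [Site.shift]
  have e3 : (stagPhase x - 2 = 1) ↔ stagPhase x = 3 := by constructor <;> intro h <;> linear_combination h
  rw [hx]
  unfold plaqAt
  rw [dif_pos hi]
  have he : ((x.shift 3, i) : Edge 4 L) = tLink3 ((x, ⟨(i, 3), hi⟩) : Plaquette 4 L) := rfl
  have s : tstapleLinks ((x, ⟨(i, 3), hi⟩) : Plaquette 4 L) (x.shift 3, i) =
      ![tLink2 (x, ⟨(i, 3), hi⟩), tLink1 (x, ⟨(i, 3), hi⟩), tLink4 (x, ⟨(i, 3), hi⟩)] := by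
    rw [he]; exact tstapleLinks_tLink3 hL1 _
  simp only [slotSum_eq, s, Matrix.cons_val_zero, Matrix.cons_val_one, Matrix.head_cons, Matrix.cons_val_two,
    Matrix.tail_cons]
  simp only [tLink1, tLink2, tLink4, temporal_not_mem_staggerForest, spatial_not_mem_staggerForest hi3,
    not_false_eq_true, ite_true, phaseWeight_spatial u uT _ hi3, phaseWeight_temporal, stagPhase_shift_ne hi3, e3]

/-! ## 3. The weighted rows of the staggered forest with phase-class weights -/

/-- **Space-like row, six plaquettes exactly** (`L ≥ 4`): the weighted row of `e = (x + e₃, i)` (`i` space-like,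
`j₁, j₂` the other two space-like directions, class `a = stagPhase x`) is at most
`2(2u(a−2) + u(a)) + 2(u(a) + 2u(a+2)) + ([a=2]uT + u(a+1) + [a=0]uT) + ([a=3]uT + u(a−1) + [a=1]uT)`. [folklore] -/
theorem weightedRow_phase_spatial (hL : 4 ≤ L) {u : ZMod L → ℝ} {uT : ℝ} (hu : ∀ a, 0 ≤ u a) (huT : 0 ≤ uT)
    (x : Site 4 L) {i j₁ j₂ : Fin 4} (hi : i < 3) (hj₁ : j₁ ≠ 3) (hj₂ : j₂ ≠ 3) (h₁ : i ≠ j₁) (h₂ : i ≠ j₂)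
    (hcov : ∀ j : Fin 4, i ≠ j → j = j₁ ∨ j = j₂ ∨ j = 3) :
    weightedRow (staggerForest L) (phaseWeight u uT) (x.shift 3, i) ≤
      2 * (2 * u (stagPhase x - 2) + u (stagPhase x)) + 2 * (u (stagPhase x) + 2 * u (stagPhase x + 2)) +
        ((if stagPhase x = 2 then uT else 0) + u (stagPhase x + 1) + (if stagPhase x = 0 then uT else 0)) +
        ((if stagPhase x = 3 then uT else 0) + u (stagPhase x - 1) + (if stagPhase x = 1 then uT else 0)) := by
  classical
  have hi3 : i ≠ 3 := ne_of_lt hi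
  have hw0 : ∀ y, 0 ≤ phaseWeight u uT y := phaseWeight_nonneg hu huT
  have hnn : ∀ q, 0 ≤ slotSum (staggerForest L) (phaseWeight u uT) ((x.shift 3, i) : Edge 4 L) q :=
    fun q => slotSum_nonneg (staggerForest L) hw0 _ q
  have hsub : plaqsThrough ((x.shift 3, i) : Edge 4 L) ⊆
      insert (plaqAt (x.shift 3) i j₁ h₁) (insert (plaqAt (x.shift 3 - Pi.single j₁ 1) i j₁ h₁)
        (insert (plaqAt (x.shift 3) i j₂ h₂) (insert (plaqAt (x.shift 3 - Pi.single j₂ 1) i j₂ h₂)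
          (insert (plaqAt (x.shift 3) i 3 hi3) {plaqAt (x.shift 3 - Pi.single 3 1) i 3 hi3})))) := by
    intro q hq
    obtain ⟨j, h, hq⟩ := mem_plaqsThrough_spatial hq
    rcases hcov j h with rfl | rfl | rfl <;> rcases hq with rfl | rfl <;> simp
  refine (weightedRow_le_sum_slotSum (staggerForest L) hw0 _).trans ?_
  refine (sum_le_sum_of_subset_of_nonneg hsub fun q _ _ => hnn q).trans ?_
  refine (sum_six_le _ _ _ _ _ _ hnn).trans ?_
  rw [slotSum_up_spatial hL u uT x hi3 hj₁ h₁, slotSum_down_spatial hL u uT x hi3 hj₁ h₁,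
    slotSum_up_spatial hL u uT x hi3 hj₂ h₂, slotSum_down_spatial hL u uT x hi3 hj₂ h₂, slotSum_up_three u uT x hi,
    slotSum_down_three hL u uT x hi]
  linarith

/-- **Every plaquette through a dynamic time-like link has weighted free slots `u 0 + u 1` or `u 2 + u 3`**
(`L ≥ 4`): through `(x, 3)` with `stagPhase x = 1` pass only `(x, (j,3))` (space-like staples of classes `1`, `0`;
time-like staple frozen) and `(x − e_j, (j,3))` (classes `3`, `2`). [folklore] -/
theorem slotSum_phase_temporal (hL : 4 ≤ L) (u : ZMod L → ℝ) (uT : ℝ) {M : ℝ} (hM0 : u 0 + u 1 ≤ M)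
    (hM2 : u 2 + u 3 ≤ M) (x : Site 4 L) (hx : stagPhase x = 1) {q : Plaquette 4 L}
    (hq : q ∈ plaqsThrough ((x, 3) : Edge 4 L)) :
    slotSum (staggerForest L) (phaseWeight u uT) (x, 3) q ≤ M := by
  classical
  have hL1 : 1 < L := by omega
  obtain ⟨-, h02, -, -, h13, -⟩ := zmod_small_ne hL
  obtain ⟨z, ⟨⟨μ, ν⟩, hμν⟩⟩ := q
  have hμ3 : μ ≠ 3 := by
    intro h; subst h
    exact absurd hμν (not_lt.2 (Fin.le_last ν))
  rw [mem_plaqsThrough, plaqEdgesT_eq] at hq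
  simp only [Finset.mem_insert, Finset.mem_singleton] at hq
  rcases hq with h | h | h | h
  · exact absurd (congrArg Prod.snd h).symm hμ3
  · -- `e = tLink2 q`: `ν = 3`, `x = z + e_μ`, classes `3` and `2`
    have hν : ν = 3 := ((congrArg Prod.snd h).symm : ν = 3)
    subst hν
    have hxz : x = z.shift μ := congrArg Prod.fst h
    have hz : stagPhase z = 3 := by
      have := stagPhase_shift_ne (x := z) hμ3
      rw [← hxz, hx] at this
      linear_combination -this
    have hno : ¬ stagPhase z = 1 := by rw [hz]; exact fun h' => h13 h'.symm
    have c6 : stagPhase z + 1 - 1 = 3 := by rw [hz]; ring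
    have c7 : stagPhase z - 1 = 2 := by rw [hz]; ring
    have s2 : tstapleLinks ((z, ⟨(μ, 3), hμν⟩) : Plaquette 4 L) (x, 3) =
        ![tLink3 (z, ⟨(μ, 3), hμν⟩), tLink4 (z, ⟨(μ, 3), hμν⟩), tLink1 (z, ⟨(μ, 3), hμν⟩)] := by
      rw [h]; exact tstapleLinks_tLink2 _
    simp only [slotSum_eq, s2, Matrix.cons_val_zero, Matrix.cons_val_one, Matrix.head_cons, Matrix.cons_val_two,
      Matrix.tail_cons]
    simp only [tLink1, tLink3, tLink4, temporal_not_mem_staggerForest, hno, spatial_not_mem_staggerForest hμ3,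
      not_false_eq_true, ite_true, ite_false, phaseWeight_spatial u uT _ hμ3, stagPhase_shift_three, c6, c7]
    linarith
  · exact absurd (congrArg Prod.snd h).symm hμ3
  · -- `e = tLink4 q`: `ν = 3`, `z = x`, classes `1` and `0`
    have hν : ν = 3 := ((congrArg Prod.snd h).symm : ν = 3)
    subst hν
    have hxz : x = z := congrArg Prod.fst h
    subst hxz
    have hno : ¬ (stagPhase x - 2 = 1) := fun h' => h02 (by rw [hx] at h'; linear_combination h')
    have c8 : stagPhase x + 1 - 1 = 1 := by rw [hx]; ring
    have c9 : stagPhase x - 1 = 0 := by rw [hx]; ring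
    have s4 : tstapleLinks ((x, ⟨(μ, 3), hμν⟩) : Plaquette 4 L) (x, 3) =
        ![tLink3 (x, ⟨(μ, 3), hμν⟩), tLink2 (x, ⟨(μ, 3), hμν⟩), tLink1 (x, ⟨(μ, 3), hμν⟩)] := by
      rw [h]; exact tstapleLinks_tLink4 hL1 _
    simp only [slotSum_eq, s4, Matrix.cons_val_zero, Matrix.cons_val_one, Matrix.head_cons, Matrix.cons_val_two,
      Matrix.tail_cons]
    simp only [tLink1, tLink2, tLink3, temporal_not_mem_staggerForest, stagPhase_shift_ne hμ3, hno,
      spatial_not_mem_staggerForest hμ3, not_false_eq_true, ite_true, ite_false, phaseWeight_spatial u uT _ hμ3,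
      stagPhase_shift_three, c8, c9]
    linarith

/-- **Dynamic time-like row** (`L ≥ 4`): at most six plaquettes of weighted free slots `≤ M` each
(`M ≥ u 0 + u 1`, `M ≥ u 2 + u 3`, `M ≥ 0`). [folklore] -/
theorem weightedRow_phase_temporal (hL : 4 ≤ L) {u : ZMod L → ℝ} {uT M : ℝ} (hu : ∀ a, 0 ≤ u a) (huT : 0 ≤ uT)
    (hM : 0 ≤ M) (hM0 : u 0 + u 1 ≤ M) (hM2 : u 2 + u 3 ≤ M) (x : Site 4 L)
    (hx : (x, (3 : Fin 4)) ∉ staggerForest L) :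
    weightedRow (staggerForest L) (phaseWeight u uT) (x, 3) ≤ 6 * M := by
  classical
  rw [temporal_not_mem_staggerForest] at hx
  refine (weightedRow_le_sum_slotSum (staggerForest L) (phaseWeight_nonneg hu huT) _).trans ?_
  have h6 : ((plaqsThrough ((x, 3) : Edge 4 L)).card : ℝ) ≤ 6 := by
    have : (plaqsThrough ((x, 3) : Edge 4 L)).card ≤ 6 := by simpa using card_plaqsThrough_le ((x, 3) : Edge 4 L)
    exact_mod_cast this
  calc ∑ q ∈ plaqsThrough ((x, 3) : Edge 4 L), slotSum (staggerForest L) (phaseWeight u uT) (x, 3) q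
      ≤ ∑ _q ∈ plaqsThrough ((x, 3) : Edge 4 L), M :=
        sum_le_sum fun q hq => slotSum_phase_temporal hL u uT hM0 hM2 x hx hq
    _ ≤ 6 * M := by rw [sum_const, nsmul_eq_mul]; nlinarith

/-- **W4b, per volume**: on every torus of side `L ≥ 4`, a nonnegative table `(u, uT)` with
`6 max(u 0 + u 1, u 2 + u 3) ≤ ρ uT` (time-like rows) and, for every class `a`,
`4u(a−2) + 4u(a) + 4u(a+2) + u(a+1) + u(a−1) + ([a=2]+[a=0]+[a=3]+[a=1]) uT ≤ ρ u(a)` (space-like rows) makes the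
staggered temporal forest satisfy the weighted row inequality `∑_{y ∉ F} n(e,y) w(y) ≤ ρ w(e)` for the phase-class
weights `w = phaseWeight u uT`. [folklore] -/
theorem weightedRow_phase_le (hL : 4 ≤ L) {u : ZMod L → ℝ} {uT ρ M : ℝ} (hu : ∀ a, 0 ≤ u a) (huT : 0 ≤ uT)
    (hM : 0 ≤ M) (hM0 : u 0 + u 1 ≤ M) (hM2 : u 2 + u 3 ≤ M) (hT : 6 * M ≤ ρ * uT)
    (hS : ∀ a : ZMod L, 4 * u (a - 2) + 4 * u a + 4 * u (a + 2) + u (a + 1) + u (a - 1) +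
      ((if a = 2 then uT else 0) + (if a = 0 then uT else 0) + (if a = 3 then uT else 0) +
        (if a = 1 then uT else 0)) ≤ ρ * u a)
    (e : Edge 4 L) (he : e ∉ staggerForest L) :
    weightedRow (staggerForest L) (phaseWeight u uT) e ≤ ρ * phaseWeight u uT e := by
  obtain ⟨z, i⟩ := e
  by_cases hi : i = 3
  · subst hi
    rw [phaseWeight_temporal]
    exact (weightedRow_phase_temporal hL hu huT hM hM0 hM2 z he).trans hT
  · have hi3 : i < 3 := by
      apply Fin.lt_def.2
      have h1 : (i : ℕ) ≠ 3 := fun h => hi (Fin.ext h)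
      have h2 : (i : ℕ) < 4 := i.isLt
      show (i : ℕ) < 3
      omega
    have hz : (z - Pi.single 3 1 : Site 4 L).shift 3 = z := by simp [Site.shift]
    have c2 : stagPhase (z - Pi.single 3 1 : Site 4 L) + 1 - 1 = stagPhase (z - Pi.single 3 1 : Site 4 L) := by ring
    rw [← hz, phaseWeight_spatial u uT _ hi, stagPhase_shift_three, c2]
    have key : ∀ {j₁ j₂ : Fin 4}, j₁ ≠ 3 → j₂ ≠ 3 → i ≠ j₁ → i ≠ j₂ → (∀ j : Fin 4, i ≠ j → j = j₁ ∨ j = j₂ ∨ j = 3) →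
        weightedRow (staggerForest L) (phaseWeight u uT) ((z - Pi.single 3 1 : Site 4 L).shift 3, i) ≤
          ρ * u (stagPhase (z - Pi.single 3 1 : Site 4 L)) := by
      intro j₁ j₂ hj₁ hj₂ h₁ h₂ hcov
      have h := weightedRow_phase_spatial hL hu huT (z - Pi.single 3 1) hi3 hj₁ hj₂ h₁ h₂ hcov
      have hSa := hS (stagPhase (z - Pi.single 3 1 : Site 4 L))
      linarith
    have hi' : i = 0 ∨ i = 1 ∨ i = 2 := by
      have h2 : (i : ℕ) < 3 := Fin.lt_def.1 hi3
      rcases Nat.lt_succ_iff_lt_or_eq.1 h2 with h | h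
      · rcases Nat.lt_succ_iff_lt_or_eq.1 h with h' | h'
        · left; exact Fin.ext (by simpa using Nat.lt_one_iff.1 h')
        · right; left; exact Fin.ext h'
      · right; right; exact Fin.ext h
    rcases hi' with rfl | rfl | rfl
    · exact key (j₁ := 1) (j₂ := 2) (by decide) (by decide) (by decide) (by decide) (by decide)
    · exact key (j₁ := 0) (j₂ := 2) (by decide) (by decide) (by decide) (by decide) (by decide)
    · exact key (j₁ := 0) (j₂ := 1) (by decide) (by decide) (by decide) (by decide) (by decide)

end Summit.QuantumFields.BalabanUV.InfraRed.StrongCouplingStaggerPhaseWeights
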